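import Literature.Analysis.FluidPDE.PineauVicolEnstrophyIdentity
import Literature.Analysis.FluidPDE.PineauVicolSliceEnstrophy
import Literature.Analysis.FluidPDE.SpaceTimeRescaling
import Mathlib.Analysis.Calculus.MeanValue
import Mathlib.Analysis.SpecialFunctions.Pow.Deriv
import HarnessLib

/-!
# Pineau–Vicol (2026), Lemma 9.4: propagation of small vorticity (physical variables)

The dynamical input `hA` of the reduction of [PineauVicol2026, Thm. 1.9]
(`pineauVicol2026_oneSlice_regularity`) to Lemma 9.4 and Proposition 9.5:
`pineauVicol_smallVorticity_propagation` — smallness of the vorticity of a Type I classical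
solution on one parabolic ball `B(2R√(−t̄))` at time `t̄` propagates, as smallness of the full
gradient on `B(½R√(−t))`, to all later times `t ∈ [t̄, 0)`.

The proof follows [PineauVicol2026, proof of Lemma 9.4, pp. 31–32] with the fixed-slice
inequality of `PineauVicolSliceEnstrophy` (where the paper's `L⁴` div–curl estimate is replaced
by the `L²` div–curl identity, at the price of the order-`2` Type I bound (9.4), which
Corollary 9.3 provides) and the enstrophy identity of `PineauVicolEnstrophyIdentity`:

* `le_of_deriv_barrier` — the continuity ("barrier") argument: `G(t̄) ≤ θ²/4` and
  `(−t)G' ≤ θ²/16 − G/4` while `G ≤ θ²` force `G ≤ θ²/4` on `[t̄, 0)`;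
* `profileAt_contDiff`, `profileAt_divergence_eq_zero`, `profileAt_bounds` — the profile
  `U(y) = √(−s) ũ(s, √(−s) y)` of the cut-off field at time `s` is `C³`, divergence free on
  `B_{5R}` and obeys the Type I bounds (9.4)–(9.5) of orders `0, 1, 2` on `B̄_{4R}`;
* `weightedEnstrophy_eq_profile`, `weightedEnstrophy_le_of_setLIntegral_le` — the weighted
  enstrophy `G(s) = ∫ψ(s)|curl ũ(s)|²` is the local enstrophy `F²` of the profile, and the
  one-slice hypothesis gives `G(t̄) ≤ θ²/4` ((9.6));
* `hasDerivAt_weightedEnstrophy_similarity` — `(−s)G'(s) = −½F² + E − 2D² + S` ((9.9));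
* `setLIntegral_frobeniusNormSq_profile_le`, `setLIntegral_frobeniusNormSq_physical_le` — the
  final step `‖∇U‖_{L²(B_{R/2})} ≤ 2θ` (via `V♭ = χ♭U` and the `L²` div–curl identity) and its
  physical-variable form.

## References

* B. Pineau, V. Vicol, *On rotated backwards self-similar solutions of the incompressible 3D
  Navier–Stokes equations*, arXiv:2607.09619 (2026), Lemma 9.4, pp. 31–32. [PineauVicol2026]
-/

noncomputable section

open MeasureTheory Set Function Filter Metric TopologicalSpace InnerProductSpace
open _root_.Topology
open scoped ENNReal NNReal InnerProductSpace RealInnerProductSpace Laplacian ContDiff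

namespace Literature.Analysis.FluidPDE


/-- **The barrier argument of Pineau–Vicol, Lemma 9.4** ("integrating in time … by the standard
continuity argument"): if `G` is continuous on `[a, b] ⊆ (−∞, 0)`, `G(a) ≤ θ²/4`, and at every
interior time where `G ≤ θ²` it is differentiable with `(−t) G'(t) ≤ θ²/16 − G(t)/4`, then
`G ≤ θ²/4` on `[a, b]` (the function `(G − θ²/4)(−t)^{−1/4}` is nonincreasing as long as
`G ≤ θ²`, and `G` cannot reach `θ²` before exceeding `θ²/4`). [cite: PineauVicol2026, proof of Lemma 9.4, arXiv:2607.09619 p. 32] -/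
theorem le_of_deriv_barrier {G : ℝ → ℝ} {a b θ : ℝ} (hab : a ≤ b) (hb : b < 0) (hθ : 0 < θ)
    (hcont : ContinuousOn G (Icc a b))
    (hder : ∀ t ∈ Ioo a b, G t ≤ θ ^ 2 →
      ∃ g : ℝ, HasDerivAt G g t ∧ g * (-t) ≤ θ ^ 2 / 16 - G t / 4)
    (ha : G a ≤ θ ^ 2 / 4) : ∀ t ∈ Icc a b, G t ≤ θ ^ 2 / 4 := by
  -- the barrier on an interval where `G ≤ θ²`
  have key : ∀ b' ∈ Icc a b, (∀ s ∈ Icc a b', G s ≤ θ ^ 2) → ∀ t ∈ Icc a b', G t ≤ θ ^ 2 / 4 := by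
    intro b' hb' hall t ht
    have hb'0 : b' < 0 := lt_of_le_of_lt hb'.2 hb
    -- `Ψ(t) = (G t − θ²/4) (−t)^{−1/4}`
    set Ψ : ℝ → ℝ := fun t => (G t - θ ^ 2 / 4) * (-t) ^ (-(1 / 4 : ℝ)) with hΨ
    have hcontG : ContinuousOn G (Icc a b') := hcont.mono (Icc_subset_Icc le_rfl hb'.2)
    have hΨc : ContinuousOn Ψ (Icc a b') := by
      refine (hcontG.sub continuousOn_const).mul ?_
      refine ContinuousOn.rpow_const (continuousOn_id.neg) fun x hx => Or.inl ?_
      simp only [ne_eq, neg_eq_zero]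
      exact (lt_of_le_of_lt hx.2 hb'0).ne
    have hΨd : ∀ x ∈ Ioo a b', HasDerivAt Ψ 0 x ∨ ∃ d, HasDerivAt Ψ d x ∧ d ≤ 0 := by
      intro x hx
      right
      have hx0 : x < 0 := lt_trans hx.2 hb'0
      have hxab : x ∈ Ioo a b := ⟨hx.1, lt_of_lt_of_le hx.2 hb'.2⟩
      obtain ⟨g, hg, hgle⟩ := hder x hxab (hall x (Ioo_subset_Icc_self hx))
      have hw : HasDerivAt (fun t : ℝ => (-t) ^ (-(1 / 4 : ℝ)))
          ((-1) * (-(1 / 4 : ℝ)) * (-x) ^ (-(1 / 4 : ℝ) - 1)) x :=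
        (hasDerivAt_neg x).rpow_const (Or.inl (by linarith))
      have hΨ' := (hg.sub_const (θ ^ 2 / 4)).mul hw
      refine ⟨_, hΨ', ?_⟩
      -- sign of the derivative
      have hm : 0 < (-x) ^ (-(1 / 4 : ℝ) - 1) := Real.rpow_pos_of_pos (by linarith) _
      have hsplit : (-x) ^ (-(1 / 4 : ℝ)) = (-x) ^ (-(1 / 4 : ℝ) - 1) * (-x) := by
        rw [Real.rpow_sub_one (by linarith), div_mul_cancel₀ _ (by linarith : (-x) ≠ 0)]
      rw [hsplit]
      have h1 : g * ((-x) ^ (-(1 / 4 : ℝ) - 1) * -x) +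
          (G x - θ ^ 2 / 4) * (-1 * -(1 / 4 : ℝ) * (-x) ^ (-(1 / 4 : ℝ) - 1)) =
          (-x) ^ (-(1 / 4 : ℝ) - 1) * (g * -x + (G x - θ ^ 2 / 4) / 4) := by ring
      rw [h1]
      exact mul_nonpos_of_nonneg_of_nonpos hm.le (by linarith)
    have hanti : AntitoneOn Ψ (Icc a b') := by
      refine antitoneOn_of_deriv_nonpos (convex_Icc a b') hΨc ?_ ?_
      · rw [interior_Icc]
        intro x hx
        rcases hΨd x hx with h | ⟨d, hd, -⟩
        · exact h.differentiableAt.differentiableWithinAt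
        · exact hd.differentiableAt.differentiableWithinAt
      · rw [interior_Icc]
        intro x hx
        rcases hΨd x hx with h | ⟨d, hd, hdle⟩
        · rw [h.deriv]
        · rw [hd.deriv]; exact hdle
    have hΨa : Ψ a ≤ 0 := by
      have ha0 : a < 0 := lt_of_le_of_lt (hb'.1.trans hb'.2) hb
      exact mul_nonpos_of_nonpos_of_nonneg (by linarith) (Real.rpow_nonneg (by linarith) _)
    have hΨt : Ψ t ≤ 0 := (hanti (left_mem_Icc.2 hb'.1) ht ht.1).trans hΨa
    have ht0 : t < 0 := lt_of_le_of_lt ht.2 hb'0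
    have hpos : 0 < (-t) ^ (-(1 / 4 : ℝ)) := Real.rpow_pos_of_pos (by linarith) _
    have : G t - θ ^ 2 / 4 ≤ 0 := by
      by_contra h
      push Not at h
      exact absurd hΨt (not_le.2 (mul_pos h hpos))
    linarith
  -- the continuity argument
  intro t ht
  by_contra hcon
  push Not at hcon
  -- the closed sets `{G ≥ θ²}` and `{G ≤ θ²}` relative to `[a, b]`
  have hVc : IsClosed {s ∈ Icc a b | θ ^ 2 ≤ G s} :=
    hcont.preimage_isClosed_of_isClosed isClosed_Icc isClosed_Ici
  have hWc : IsClosed {s ∈ Icc a b | G s ≤ θ ^ 2} :=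
    hcont.preimage_isClosed_of_isClosed isClosed_Icc isClosed_Iic
  by_cases hV : {s ∈ Icc a b | θ ^ 2 < G s} = ∅
  · -- `G ≤ θ²` everywhere: the barrier applies up to `b`
    have hall : ∀ s ∈ Icc a b, G s ≤ θ ^ 2 := by
      intro s hs
      by_contra h
      push Not at h
      have : s ∈ {s ∈ Icc a b | θ ^ 2 < G s} := ⟨hs, h⟩
      rw [hV] at this
      exact this
    have := key b (right_mem_Icc.2 hab) hall t ht
    linarith
  · -- the first time `G` reaches `θ²`
    obtain ⟨s₀, hs₀⟩ := nonempty_iff_ne_empty.2 hV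
    set V : Set ℝ := {s ∈ Icc a b | θ ^ 2 < G s} with hVdef
    have hVbdd : BddBelow V := ⟨a, fun s hs => hs.1.1⟩
    have hVne : V.Nonempty := ⟨s₀, hs₀⟩
    set t₃ : ℝ := sInf V with ht₃
    have ht₃mem : t₃ ∈ closure V := csInf_mem_closure hVne hVbdd
    have hclV : closure V ⊆ {s ∈ Icc a b | θ ^ 2 ≤ G s} :=
      closure_minimal (fun s hs => ⟨hs.1, hs.2.le⟩) hVc
    have ht₃' := hclV ht₃mem
    have ht₃ab : t₃ ∈ Icc a b := ht₃'.1
    have hGt₃ : θ ^ 2 ≤ G t₃ := ht₃'.2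
    have hat₃ : a < t₃ := by
      rcases eq_or_lt_of_le ht₃ab.1 with h | h
      · exfalso
        rw [← h] at hGt₃
        nlinarith
      · exact h
    -- below `t₃`, `G ≤ θ²`
    have hbelow : ∀ s ∈ Ico a t₃, G s ≤ θ ^ 2 := by
      intro s hs
      by_contra h
      push Not at h
      have hsV : s ∈ V := ⟨⟨hs.1, hs.2.le.trans ht₃ab.2⟩, h⟩
      exact absurd (csInf_le hVbdd hsV) (not_le.2 hs.2)
    have hGt₃le : G t₃ ≤ θ ^ 2 := by
      have hsub : Ico a t₃ ⊆ {s ∈ Icc a b | G s ≤ θ ^ 2} := fun s hs =>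
        ⟨⟨hs.1, hs.2.le.trans ht₃ab.2⟩, hbelow s hs⟩
      have hcl : t₃ ∈ closure (Ico a t₃) := by
        rw [closure_Ico hat₃.ne]; exact right_mem_Icc.2 hat₃.le
      exact ((closure_minimal hsub hWc) hcl).2
    have hall : ∀ s ∈ Icc a t₃, G s ≤ θ ^ 2 := by
      intro s hs
      rcases eq_or_lt_of_le hs.2 with h | h
      · rw [h]; exact hGt₃le
      · exact hbelow s ⟨hs.1, h⟩
    have := key t₃ ht₃ab hall t₃ (right_mem_Icc.2 hat₃.le)
    nlinarith



section ProfileAtTime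

-- nested operator types
set_option maxSynthPendingDepth 3

variable {u : ℝ → EuclideanSpace ℝ (Fin 3) → EuclideanSpace ℝ (Fin 3)}
  {p : ℝ → EuclideanSpace ℝ (Fin 3) → ℝ} {ζ : EuclideanSpace ℝ (Fin 3) → ℝ}
  {ut : ℝ → EuclideanSpace ℝ (Fin 3) → EuclideanSpace ℝ (Fin 3)}
  {U : EuclideanSpace ℝ (Fin 3) → EuclideanSpace ℝ (Fin 3)} {s c R c₁ Cu K K₂ : ℝ}

/-- The similarity profile `U(y) = c ũ(s, c y)` of the cut-off field is `C³` (indeed smooth). [folklore] -/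
theorem profileAt_contDiff
    (hreg : IsClassicalNSSolutionOnRegion
      (Ico (-1 : ℝ) 0 ×ˢ ball (0 : EuclideanSpace ℝ (Fin 3)) 1) 1 0 u p)
    (hζ : ContDiff ℝ ∞ ζ) (hζs : tsupport ζ ⊆ ball (0 : EuclideanSpace ℝ (Fin 3)) 1)
    (hut : ut = fun t x => ζ x • u t x) (hs : s ∈ Ioo (-1 : ℝ) 0)
    (hU : U = fun y => c • ut s (c • y)) : ContDiff ℝ 3 U := by
  have hsm : IsSmoothSpaceTimeOn (Ioo (-1 : ℝ) 0) ut := by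
    rw [hut]; exact isSmoothSpaceTimeOn_cutoff_smul hreg.smooth_velocity hζ hζs
  have h := hsm.contDiff_slice hs
  rw [hU]
  exact ((h.of_le (by norm_cast)).comp (contDiff_const_smul c)).const_smul c

/-- The similarity profile is divergence free on `B(0, 5R)` when `5Rc < ½` (there `c y` lies in
the plateau of the cut-off, where `div ũ = div u = 0`). [folklore] -/
theorem profileAt_divergence_eq_zero
    (hreg : IsClassicalNSSolutionOnRegion
      (Ico (-1 : ℝ) 0 ×ˢ ball (0 : EuclideanSpace ℝ (Fin 3)) 1) 1 0 u p)
    (hζ1 : ∀ x ∈ ball (0 : EuclideanSpace ℝ (Fin 3)) (1 / 2), ζ =ᶠ[𝓝 x] fun _ => (1 : ℝ))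
    (hut : ut = fun t x => ζ x • u t x) (hs : s ∈ Ioo (-1 : ℝ) 0) (hc : 0 < c)
    (h5 : 5 * R * c < 1 / 2)
    (hU : U = fun y => c • ut s (c • y)) {y : EuclideanSpace ℝ (Fin 3)} (hy : ‖y‖ < 5 * R) :
    VectorCalculus.divergence U y = 0 := by
  rw [hU, divergence_smul_comp_smul]
  have hcy : c • y ∈ ball (0 : EuclideanSpace ℝ (Fin 3)) (1 / 2) := by
    rw [mem_ball_zero_iff, norm_smul, Real.norm_of_nonneg hc.le]
    nlinarith
  rw [divergence_cutoff_eq_zero hreg hζ1 hut hs hcy, mul_zero]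

/-- **The Type I bounds of the similarity profile** on `B̄(0, 4R)` (Pineau–Vicol (9.4)–(9.5) with
`k ≤ 2`): if `4Rc < ½`, `c(1 + 4R) ≤ c₁`, then for `|y| ≤ 4R`,
`|U(y)| ≤ C_u/(1+|y|)`, `|DU(y)| ≤ K/(1+|y|)²`, `|D²U(y)| ≤ K₂/(1+|y|)³`
(from the Type I bound (1.15) and the gradient bounds of orders `1, 2` at `x = c y`, where
`|x| + √(−s) = c(1 + |y|)`). [cite: PineauVicol2026, Cor. 9.3 (9.4)–(9.5), arXiv:2607.09619 p. 30] -/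
theorem profileAt_bounds
    (hreg : IsClassicalNSSolutionOnRegion
      (Ico (-1 : ℝ) 0 ×ˢ ball (0 : EuclideanSpace ℝ (Fin 3)) 1) 1 0 u p)
    (hI : ∀ t ∈ Ico (-1 : ℝ) 0, ∀ x ∈ ball (0 : EuclideanSpace ℝ (Fin 3)) 1,
      ‖u t x‖ ≤ Cu / (Real.sqrt (-t) + ‖x‖))
    (hK : ∀ t ∈ Ioo (-1 : ℝ) 0, ∀ x : EuclideanSpace ℝ (Fin 3), ‖x‖ + Real.sqrt (-t) ≤ c₁ →
      ‖fderiv ℝ (u t) x‖ ≤ K / (‖x‖ + Real.sqrt (-t)) ^ 2)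
    (hK₂ : ∀ t ∈ Ioo (-1 : ℝ) 0, ∀ x : EuclideanSpace ℝ (Fin 3), ‖x‖ + Real.sqrt (-t) ≤ c₁ →
      ‖iteratedFDeriv ℝ 2 (u t) x‖ ≤ K₂ / (‖x‖ + Real.sqrt (-t)) ^ 3)
    (hζ : ContDiff ℝ ∞ ζ) (hζs : tsupport ζ ⊆ ball (0 : EuclideanSpace ℝ (Fin 3)) 1)
    (hζ1 : ∀ x ∈ ball (0 : EuclideanSpace ℝ (Fin 3)) (1 / 2), ζ =ᶠ[𝓝 x] fun _ => (1 : ℝ))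
    (hut : ut = fun t x => ζ x • u t x) (hs : s ∈ Ioo (-1 : ℝ) 0) (hcs : Real.sqrt (-s) = c)
    (h4 : 4 * R * c < 1 / 2) (hcc₁ : c * (1 + 4 * R) ≤ c₁)
    (hU : U = fun y => c • ut s (c • y)) {y : EuclideanSpace ℝ (Fin 3)} (hy : ‖y‖ ≤ 4 * R) :
    ‖U y‖ ≤ Cu / (1 + ‖y‖) ∧ ‖fderiv ℝ U y‖ ≤ K / (1 + ‖y‖) ^ 2 ∧
      ‖iteratedFDeriv ℝ 2 U y‖ ≤ K₂ / (1 + ‖y‖) ^ 3 := by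
  have hc : 0 < c := by rw [← hcs]; exact Real.sqrt_pos.2 (by linarith [hs.2])
  -- the point `x = c y` lies in the plateau
  have hcy_norm : ‖c • y‖ = c * ‖y‖ := by rw [norm_smul, Real.norm_of_nonneg hc.le]
  have hcy2 : c • y ∈ ball (0 : EuclideanSpace ℝ (Fin 3)) (1 / 2) := by
    rw [mem_ball_zero_iff, hcy_norm]; nlinarith
  have hcy1 : c • y ∈ ball (0 : EuclideanSpace ℝ (Fin 3)) 1 := ball_subset_ball (by norm_num) hcy2
  have hζcy : ζ =ᶠ[𝓝 (c • y)] fun _ => (1 : ℝ) := hζ1 _ hcy2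
  have hζcy1 : ζ (c • y) = 1 := hζcy.self_of_nhds
  have hutu : ut s =ᶠ[𝓝 (c • y)] u s := by rw [hut]; exact cutoff_smul_slice_eventuallyEq hζcy s
  -- the sum `|x| + √(−s) = c (1 + |y|)`
  have hsum : ‖c • y‖ + Real.sqrt (-s) = c * (1 + ‖y‖) := by rw [hcy_norm, hcs]; ring
  have hsum_le : ‖c • y‖ + Real.sqrt (-s) ≤ c₁ := by
    rw [hsum]; exact le_trans (by nlinarith) hcc₁
  have hpos : 0 < 1 + ‖y‖ := by positivity
  refine ⟨?_, ?_, ?_⟩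
  · -- order 0
    have h0 := hI s (Ioo_subset_Ico_self hs) (c • y) hcy1
    rw [add_comm, hsum] at h0
    rw [hU]
    show ‖c • ut s (c • y)‖ ≤ Cu / (1 + ‖y‖)
    rw [hut]
    show ‖c • (ζ (c • y) • u s (c • y))‖ ≤ Cu / (1 + ‖y‖)
    rw [hζcy1, one_smul, norm_smul, Real.norm_of_nonneg hc.le]
    calc c * ‖u s (c • y)‖ ≤ c * (Cu / (c * (1 + ‖y‖))) := mul_le_mul_of_nonneg_left h0 hc.le
      _ = Cu / (1 + ‖y‖) := by field_simp
  · -- order 1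
    have h1 := hK s hs (c • y) hsum_le
    rw [hsum] at h1
    rw [hU, fderiv_smul_comp_smul, hutu.fderiv_eq, norm_smul, Real.norm_of_nonneg (by positivity)]
    calc c ^ 2 * ‖fderiv ℝ (u s) (c • y)‖ ≤ c ^ 2 * (K / (c * (1 + ‖y‖)) ^ 2) :=
          mul_le_mul_of_nonneg_left h1 (by positivity)
      _ = K / (1 + ‖y‖) ^ 2 := by field_simp
  · -- order 2
    have h2 := hK₂ s hs (c • y) hsum_le
    rw [hsum] at h2
    have hsm : IsSmoothSpaceTimeOn (Ioo (-1 : ℝ) 0) ut := by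
      rw [hut]; exact isSmoothSpaceTimeOn_cutoff_smul hreg.smooth_velocity hζ hζs
    have huts : ContDiff ℝ ∞ (ut s) := hsm.contDiff_slice hs
    have hcomp : ContDiff ℝ 2 fun z : EuclideanSpace ℝ (Fin 3) => ut s (c • z) :=
      (huts.of_le (by norm_cast)).comp (contDiff_const_smul c)
    have e : U = c • fun z => ut s (c • z) := by rw [hU]; rfl
    rw [e, iteratedFDeriv_const_smul_apply hcomp.contDiffAt, norm_smul, Real.norm_of_nonneg hc.le]
    have hb := norm_iteratedFDeriv_comp_smul_le_fin3 (huts.of_le (by norm_cast)) c y (n := 2)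
    rw [abs_of_pos hc, (hutu.iteratedFDeriv ℝ 2).eq_of_nhds] at hb
    calc c * ‖iteratedFDeriv ℝ 2 (fun z => ut s (c • z)) y‖
        ≤ c * (c ^ 2 * (K₂ / (c * (1 + ‖y‖)) ^ 3)) :=
          mul_le_mul_of_nonneg_left (hb.trans (mul_le_mul_of_nonneg_left h2 (by positivity))) hc.le
      _ = K₂ / (1 + ‖y‖) ^ 3 := by field_simp

variable {χb χ η : EuclideanSpace ℝ (Fin 3) → ℝ} {ψ : ℝ → EuclideanSpace ℝ (Fin 3) → ℝ}

/-- **The weighted enstrophy is the local enstrophy of the profile**: `∫ψ(s)|curl ũ(s)|² = ∫χ²|curl U|²`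
(`η = χ²`, `χ = χ̄(·/R)`). [folklore] -/
theorem weightedEnstrophy_eq_profile (hcs : Real.sqrt (-s) = c) (hs0 : s < 0)
    (hχ : χ = fun y => χb (R⁻¹ • y)) (hη : η = fun y => χb (R⁻¹ • y) ^ 2)
    (hψ : ψ = fun t x => Real.sqrt (-t) * η ((Real.sqrt (-t))⁻¹ • x))
    (hU : U = fun y => c • ut s (c • y)) :
    ∫ x, ψ s x * ‖curl (ut s) x‖ ^ 2 = ∫ y, χ y ^ 2 * ‖curl U y‖ ^ 2 := by
  have hc : 0 < c := by rw [← hcs]; exact Real.sqrt_pos.2 (by linarith)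
  have hψs : ψ s = fun x => c * η (c⁻¹ • x) := by rw [hψ]; funext x; simp only [hcs]
  have e1 : (fun x => ψ s x * ‖curl (ut s) x‖ ^ 2) = fun x => (c * η (c⁻¹ • x)) * ‖curl (ut s) x‖ ^ 2 := by
    funext x; rw [hψs]
  have e2 : (fun y => χ y ^ 2 * ‖curl U y‖ ^ 2) = fun y => η y * ‖curl U y‖ ^ 2 := by
    funext y; rw [hχ, hη]
  rw [show (∫ x, ψ s x * ‖curl (ut s) x‖ ^ 2) = ∫ x, (c * η (c⁻¹ • x)) * ‖curl (ut s) x‖ ^ 2 by rw [e1],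
    show (∫ y, χ y ^ 2 * ‖curl U y‖ ^ 2) = ∫ y, η y * ‖curl U y‖ ^ 2 by rw [e2]]
  exact integral_weight_mul_sq_norm_curl_eq hc hU

end ProfileAtTime


section InitialAndFinal

-- nested operator types
set_option maxSynthPendingDepth 3

variable {u : ℝ → EuclideanSpace ℝ (Fin 3) → EuclideanSpace ℝ (Fin 3)}
  {p : ℝ → EuclideanSpace ℝ (Fin 3) → ℝ} {ζ : EuclideanSpace ℝ (Fin 3) → ℝ}
  {ut : ℝ → EuclideanSpace ℝ (Fin 3) → EuclideanSpace ℝ (Fin 3)}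
  {U : EuclideanSpace ℝ (Fin 3) → EuclideanSpace ℝ (Fin 3)}
  {χb χ η : EuclideanSpace ℝ (Fin 3) → ℝ} {ψ : ℝ → EuclideanSpace ℝ (Fin 3) → ℝ}
  {s c R Cu C₁ θ : ℝ}

/-- **The initial bound**: the one-slice hypothesis
`∫_{B(2R√(−t̄))} |ω(t̄)|² ≤ θ²/(4√(−t̄))` gives `∫ψ(t̄)|curl ũ(t̄)|² ≤ θ²/4`
(`0 ≤ ψ ≤ √(−t̄)`, `supp ψ(t̄) ⊆ B(2R√(−t̄)) ⊆ B(0,½)` where `ũ = u`). [cite: PineauVicol2026, Lemma 9.4 (9.6), arXiv:2607.09619 p. 31] -/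
theorem weightedEnstrophy_le_of_setLIntegral_le
    (hreg : IsClassicalNSSolutionOnRegion
      (Ico (-1 : ℝ) 0 ×ˢ ball (0 : EuclideanSpace ℝ (Fin 3)) 1) 1 0 u p)
    (hζ : ContDiff ℝ ∞ ζ) (hζs : tsupport ζ ⊆ ball (0 : EuclideanSpace ℝ (Fin 3)) 1)
    (hζ1 : ∀ x ∈ ball (0 : EuclideanSpace ℝ (Fin 3)) (1 / 2), ζ =ᶠ[𝓝 x] fun _ => (1 : ℝ))
    (hut : ut = fun t x => ζ x • u t x)
    (hχb0 : ∀ x, 2 ≤ ‖x‖ → χb x = 0) (hχb01 : ∀ x, |χb x| ≤ 1) (hR : 0 < R)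
    (hη : η = fun y => χb (R⁻¹ • y) ^ 2)
    (hψ : ψ = fun t x => Real.sqrt (-t) * η ((Real.sqrt (-t))⁻¹ • x))
    (hs : s ∈ Ioo (-1 : ℝ) 0) (hcs : Real.sqrt (-s) = c) (h2 : 2 * R * c < 1 / 2)
    (H : ∫⁻ x in ball (0 : EuclideanSpace ℝ (Fin 3)) (2 * R * c), ENNReal.ofReal (‖curl (u s) x‖ ^ 2) ≤
      ENNReal.ofReal (θ ^ 2 / (4 * c))) :
    ∫ x, ψ s x * ‖curl (ut s) x‖ ^ 2 ≤ θ ^ 2 / 4 := by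
  have hc : 0 < c := by rw [← hcs]; exact Real.sqrt_pos.2 (by linarith [hs.2])
  have hsm : IsSmoothSpaceTimeOn (Ioo (-1 : ℝ) 0) ut := by
    rw [hut]; exact isSmoothSpaceTimeOn_cutoff_smul hreg.smooth_velocity hζ hζs
  have huts : ContDiff ℝ ∞ (ut s) := hsm.contDiff_slice hs
  have hcurlc : Continuous (curl (ut s)) := continuous_curl (huts.of_le (by norm_cast))
  -- `curl ũ = curl u` on `B(0, ½)`
  have hcurl_eq : ∀ x ∈ ball (0 : EuclideanSpace ℝ (Fin 3)) (1 / 2), curl (ut s) x = curl (u s) x := by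
    intro x hx
    have hux : ut s =ᶠ[𝓝 x] u s := by rw [hut]; exact cutoff_smul_slice_eventuallyEq (hζ1 x hx) s
    rw [curl_eq_curlCLM, curl_eq_curlCLM, hux.fderiv_eq]
  -- the majorant `g = c 𝟙_{B(2Rc)} |curl u(s)|²`
  have hball : ball (0 : EuclideanSpace ℝ (Fin 3)) (2 * R * c) ⊆ ball 0 (1 / 2) := ball_subset_ball h2.le
  have hpt : ∀ x, ψ s x * ‖curl (ut s) x‖ ^ 2 ≤
      c * (ball (0 : EuclideanSpace ℝ (Fin 3)) (2 * R * c)).indicator (fun x => ‖curl (u s) x‖ ^ 2) x := by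
    intro x
    by_cases hx : x ∈ ball (0 : EuclideanSpace ℝ (Fin 3)) (2 * R * c)
    · rw [Set.indicator_of_mem hx, hcurl_eq x (hball hx)]
      have hψle : ψ s x ≤ c := by
        rw [hψ, hη]
        simp only [hcs]
        have h1 : χb (R⁻¹ • c⁻¹ • x) ^ 2 ≤ 1 := by
          have := hχb01 (R⁻¹ • c⁻¹ • x)
          rw [abs_le] at this
          nlinarith
        calc c * χb (R⁻¹ • c⁻¹ • x) ^ 2 ≤ c * 1 := mul_le_mul_of_nonneg_left h1 hc.le
          _ = c := mul_one c
      exact mul_le_mul_of_nonneg_right hψle (sq_nonneg _)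
    · rw [Set.indicator_of_notMem hx, mul_zero]
      rw [mem_ball_zero_iff, not_lt] at hx
      have h0 : ψ s x = 0 := by
        rw [hψ]
        exact selfSimilarWeight_eq_zero hχb0 hR hη hs.2 (by rw [hcs]; exact hx)
      rw [h0, zero_mul]
  have hnn : ∀ x, 0 ≤ ψ s x * ‖curl (ut s) x‖ ^ 2 := by
    intro x
    refine mul_nonneg ?_ (sq_nonneg _)
    rw [hψ, hη]
    simp only
    exact mul_nonneg (Real.sqrt_nonneg _) (sq_nonneg _)
  -- integrability of the majorant
  have hIntOn : IntegrableOn (fun x => ‖curl (u s) x‖ ^ 2) (ball (0 : EuclideanSpace ℝ (Fin 3)) (2 * R * c)) := by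
    have h1 : IntegrableOn (fun x => ‖curl (ut s) x‖ ^ 2) (ball (0 : EuclideanSpace ℝ (Fin 3)) (2 * R * c)) :=
      ((hcurlc.norm.pow 2).continuousOn.integrableOn_compact (isCompact_closedBall 0 (2 * R * c))).mono_set
        ball_subset_closedBall
    exact h1.congr_fun (fun x hx => by simp only; rw [hcurl_eq x (hball hx)]) measurableSet_ball
  have hg : Integrable fun x => c * (ball (0 : EuclideanSpace ℝ (Fin 3)) (2 * R * c)).indicator
      (fun x => ‖curl (u s) x‖ ^ 2) x :=
    (hIntOn.integrable_indicator measurableSet_ball).const_mul c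
  -- comparison of the integrals
  have step1 : ∫ x, ψ s x * ‖curl (ut s) x‖ ^ 2 ≤
      ∫ x, c * (ball (0 : EuclideanSpace ℝ (Fin 3)) (2 * R * c)).indicator (fun x => ‖curl (u s) x‖ ^ 2) x :=
    integral_mono_of_nonneg (Eventually.of_forall hnn) hg (Eventually.of_forall hpt)
  have step2 : ∫ x, c * (ball (0 : EuclideanSpace ℝ (Fin 3)) (2 * R * c)).indicator (fun x => ‖curl (u s) x‖ ^ 2) x =
      c * ∫ x in ball (0 : EuclideanSpace ℝ (Fin 3)) (2 * R * c), ‖curl (u s) x‖ ^ 2 := by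
    rw [integral_const_mul, integral_indicator measurableSet_ball]
  have step3 : ∫ x in ball (0 : EuclideanSpace ℝ (Fin 3)) (2 * R * c), ‖curl (u s) x‖ ^ 2 ≤ θ ^ 2 / (4 * c) := by
    rw [integral_eq_lintegral_of_nonneg_ae (Eventually.of_forall fun x => sq_nonneg _)
      hIntOn.aestronglyMeasurable]
    have hfin : ENNReal.ofReal (θ ^ 2 / (4 * c)) ≠ ⊤ := ENNReal.ofReal_ne_top
    have := ENNReal.toReal_mono hfin H
    rwa [ENNReal.toReal_ofReal (by positivity)] at this
  calc ∫ x, ψ s x * ‖curl (ut s) x‖ ^ 2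
      ≤ c * ∫ x in ball (0 : EuclideanSpace ℝ (Fin 3)) (2 * R * c), ‖curl (u s) x‖ ^ 2 := step1.trans_eq step2
    _ ≤ c * (θ ^ 2 / (4 * c)) := mul_le_mul_of_nonneg_left step3 hc.le
    _ = θ ^ 2 / 4 := by field_simp
set_option maxHeartbeats 400000 in -- buildfix (bf3-g26): 160k/180k FAIL, 200k PASS at accept time; line-neutral budget line
/-- **The final gradient bound in similarity variables** ("with `χ♭ = χ̄(2y/R)`, in analogy to
(9.11), `‖∇U‖_{L²(B_{R/2})} ≤ ‖∇(χ♭U)‖_{L²} ≤ ‖Ω‖_{L²(B_R)} + C''KR^{−1/2}`", here through the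
`L²` div–curl identity for `V♭ = χ♭U`): if `F² = ∫χ²|curl U|² ≤ θ²/4` and the cut-off error
`(2κ²+1)(2C₁/R)²(2C_u/R)² vol(B̄_R) ≤ θ²`, then `∫_{B(0,R/2)} |DU|²_F ≤ 2θ²`. [cite: PineauVicol2026, end of proof of Lemma 9.4, arXiv:2607.09619 p. 32] -/
theorem setLIntegral_frobeniusNormSq_profile_le (hχb : ContDiff ℝ 3 χb)
    (hχb1 : ∀ x, ‖x‖ ≤ 1 → χb x = 1) (hχb0 : ∀ x, 2 ≤ ‖x‖ → χb x = 0) (hχb01 : ∀ x, |χb x| ≤ 1)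
    (hC₁ : ∀ x, ‖fderiv ℝ χb x‖ ≤ C₁) (hR : 4 ≤ R) (hU : ContDiff ℝ 3 U)
    (hdiv : ∀ y : EuclideanSpace ℝ (Fin 3), ‖y‖ < 5 * R → VectorCalculus.divergence U y = 0)
    (hCu : 0 ≤ Cu) (h0 : ∀ y : EuclideanSpace ℝ (Fin 3), ‖y‖ ≤ 4 * R → ‖U y‖ ≤ Cu / (1 + ‖y‖))
    (hχ : χ = fun y => χb (R⁻¹ • y))
    (hG : ∫ y, χ y ^ 2 * ‖curl U y‖ ^ 2 ≤ θ ^ 2 / 4)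
    (hsmall : (2 * ‖curlCLM‖ ^ 2 + 1) * ((2 * C₁ / R) * (2 * Cu / R)) ^ 2 *
      (volume (closedBall (0 : EuclideanSpace ℝ (Fin 3)) R)).toReal ≤ θ ^ 2) :
    ∫⁻ y in ball (0 : EuclideanSpace ℝ (Fin 3)) (R / 2), ENNReal.ofReal (frobeniusNormSq (fderiv ℝ U y)) ≤
      ENNReal.ofReal (2 * θ ^ 2) := by
  have hR0 : 0 < R := by linarith
  -- the cut-off `χ♭ = χ̄(·/(R/2))` and `V♭ = χ♭ U`, through the slice lemmas with `R' = R/4`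
  obtain ⟨R', hR'⟩ : ∃ R' : ℝ, R / 4 = R' := ⟨_, rfl⟩
  have hR'1 : 1 ≤ R' := by rw [← hR']; linarith
  have hR'0 : 0 < R' := by linarith
  have h2R' : 2 * R' = R / 2 := by rw [← hR']; ring
  have h4R' : 4 * R' = R := by rw [← hR']; ring
  obtain ⟨χf, hχf⟩ : ∃ χf : EuclideanSpace ℝ (Fin 3) → ℝ, (fun y => χb ((2 * R')⁻¹ • y)) = χf := ⟨_, rfl⟩
  obtain ⟨Vf, hVf⟩ : ∃ Vf : EuclideanSpace ℝ (Fin 3) → EuclideanSpace ℝ (Fin 3), (fun y => χf y • U y) = Vf :=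
    ⟨_, rfl⟩
  have hVf3 : ContDiff ℝ 3 Vf := sliceV_contDiff hχb hU hχf.symm hVf.symm
  have hVf2 : ContDiff ℝ 2 Vf := hVf3.of_le (by norm_num)
  have hVf1 : ContDiff ℝ 1 Vf := hVf3.of_le (by norm_num)
  have hVfc : HasCompactSupport Vf := sliceV_hasCompactSupport hχb0 hR'0 hχf.symm hVf.symm
  have hχf3 : ContDiff ℝ 3 χf := by rw [← hχf]; exact hχb.comp (contDiff_const_smul _)
  have hU1 : ContDiff ℝ 1 U := hU.of_le (by norm_num)
  obtain ⟨κ, hκ⟩ : ∃ κ : ℝ, ‖curlCLM‖ = κ := ⟨_, rfl⟩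
  have hκ0 : 0 ≤ κ := by rw [← hκ]; exact norm_nonneg _
  rw [hκ] at hsmall
  obtain ⟨M, hM⟩ : ∃ M : ℝ, ((2 * C₁ / R) * (2 * Cu / R)) ^ 2 = M := ⟨_, rfl⟩
  have hM0 : 0 ≤ M := by rw [← hM]; positivity
  -- pointwise facts on the annulus `R/2 ≤ |y| ≤ R`
  have hann : ∀ y : EuclideanSpace ℝ (Fin 3), R / 2 ≤ ‖y‖ → ‖y‖ ≤ R →
      ‖fderiv ℝ χf y‖ * ‖U y‖ ≤ (2 * C₁ / R) * (2 * Cu / R) := by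
    intro y hy1 hy2
    have hC₁0 : 0 ≤ C₁ := (norm_nonneg _).trans (hC₁ 0)
    have hDχ : ‖fderiv ℝ χf y‖ ≤ 2 * C₁ / R := by
      rw [← hχf]
      refine (norm_fderiv_cutoffScale_le (hχb.of_le (by norm_num)) hC₁ (by positivity) y).trans ?_
      rw [h2R', div_div_eq_mul_div]
      exact le_of_eq (by ring)
    have hUy : ‖U y‖ ≤ 2 * Cu / R := by
      refine (h0 y (by linarith)).trans ?_
      rw [div_le_div_iff₀ (by positivity) (by positivity)]
      nlinarith
    exact mul_le_mul hDχ hUy (norm_nonneg _) (by positivity)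
  -- where `χf` is locally constant, `Dχf = 0`
  have hDχ0 : ∀ y : EuclideanSpace ℝ (Fin 3), (‖y‖ < R / 2 ∨ R < ‖y‖) → fderiv ℝ χf y = 0 := by
    intro y hy
    rcases hy with hy | hy
    · have h := cutoffScale_eventuallyEq_one hχb1 (by positivity : 0 < 2 * R') (y := y) (by rw [h2R']; exact hy)
      rw [hχf] at h
      rw [h.fderiv_eq, fderiv_const_apply]
    · have h := cutoffScale_eventuallyEq_zero hχb0 (by positivity : 0 < 2 * R') (y := y)
        (by rw [show 2 * (2 * R') = R by rw [← hR']; ring]; exact hy)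
      rw [hχf] at h
      rw [h.fderiv_eq, fderiv_const_apply]
  -- `χf² ≤ χ²`
  have hχfχ : ∀ y, χf y ^ 2 ≤ χ y ^ 2 := by
    intro y
    rcases le_or_gt ‖y‖ R with hy | hy
    · have hχ1 : χ y = 1 := by rw [hχ]; exact cutoffScale_eq_one hχb1 hR0 hy
      rw [hχ1, one_pow, ← hχf]
      have := hχb01 ((2 * R')⁻¹ • y)
      rw [abs_le] at this
      nlinarith
    · have hχf0 : χf y = 0 := by
        rw [← hχf]
        exact cutoffScale_eq_zero hχb0 (by positivity : 0 < 2 * R')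
          (by rw [show 2 * (2 * R') = R by rw [← hR']; ring]; exact hy.le)
      rw [hχf0, zero_pow two_ne_zero]; exact sq_nonneg _
  -- majorant of `|curl V♭|²`
  have hcurl : ∀ y, ‖curl Vf y‖ ^ 2 ≤ 2 * (χ y ^ 2 * ‖curl U y‖ ^ 2) +
      2 * (closedBall (0 : EuclideanSpace ℝ (Fin 3)) R).indicator (fun _ => κ ^ 2 * M) y := by
    intro y
    have hdχ : DifferentiableAt ℝ χf y := (hχf3.differentiable (by norm_num)) y
    have hdU : DifferentiableAt ℝ U y := (hU.differentiable (by norm_num)) y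
    have hcs := curl_smul (f := U) hdχ hdU
    rw [hVf] at hcs
    have hind0 : 0 ≤ (closedBall (0 : EuclideanSpace ℝ (Fin 3)) R).indicator (fun _ => κ ^ 2 * M) y :=
      Set.indicator_nonneg (fun _ _ => by positivity) _
    -- the rank-one term
    have hterm : ‖curlCLM ((fderiv ℝ χf y).smulRight (U y))‖ ^ 2 ≤
        (closedBall (0 : EuclideanSpace ℝ (Fin 3)) R).indicator (fun _ => κ ^ 2 * M) y := by
      by_cases hy : R / 2 ≤ ‖y‖ ∧ ‖y‖ ≤ R
      · rw [Set.indicator_of_mem (mem_closedBall_zero_iff.2 hy.2)]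
        have hcs' := norm_curlCLM_smulRight_le (fderiv ℝ χf y) (U y)
        rw [hκ] at hcs'
        calc ‖curlCLM ((fderiv ℝ χf y).smulRight (U y))‖ ^ 2
            ≤ (κ * (‖fderiv ℝ χf y‖ * ‖U y‖)) ^ 2 :=
              pow_le_pow_left₀ (norm_nonneg _) hcs' 2
          _ ≤ (κ * ((2 * C₁ / R) * (2 * Cu / R))) ^ 2 :=
              pow_le_pow_left₀ (by positivity) (mul_le_mul_of_nonneg_left (hann y hy.1 hy.2) hκ0) 2
          _ = κ ^ 2 * M := by rw [← hM]; ring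
      · have h0 : fderiv ℝ χf y = 0 := by
          refine hDχ0 y ?_
          by_contra hcon
          push Not at hcon
          exact hy ⟨hcon.1, hcon.2⟩
        have hz : (fderiv ℝ χf y).smulRight (U y) = 0 := by rw [h0]; ext v; simp
        rw [hz, map_zero, norm_zero, zero_pow two_ne_zero]
        exact hind0
    -- `‖a + b‖² ≤ 2‖a‖² + 2‖b‖²`
    have hχa : ‖χf y • curl U y‖ ^ 2 = χf y ^ 2 * ‖curl U y‖ ^ 2 := by
      rw [norm_smul, mul_pow, Real.norm_eq_abs, sq_abs]
    calc ‖curl Vf y‖ ^ 2 = ‖χf y • curl U y + curlCLM ((fderiv ℝ χf y).smulRight (U y))‖ ^ 2 := by rw [hcs]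
      _ ≤ (‖χf y • curl U y‖ + ‖curlCLM ((fderiv ℝ χf y).smulRight (U y))‖) ^ 2 :=
          pow_le_pow_left₀ (norm_nonneg _) (norm_add_le _ _) 2
      _ ≤ 2 * ‖χf y • curl U y‖ ^ 2 + 2 * ‖curlCLM ((fderiv ℝ χf y).smulRight (U y))‖ ^ 2 := by
          nlinarith [sq_nonneg (‖χf y • curl U y‖ - ‖curlCLM ((fderiv ℝ χf y).smulRight (U y))‖)]
      _ ≤ 2 * (χ y ^ 2 * ‖curl U y‖ ^ 2) +
          2 * (closedBall (0 : EuclideanSpace ℝ (Fin 3)) R).indicator (fun _ => κ ^ 2 * M) y := by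
          rw [hχa]
          have h1 : χf y ^ 2 * ‖curl U y‖ ^ 2 ≤ χ y ^ 2 * ‖curl U y‖ ^ 2 :=
            mul_le_mul_of_nonneg_right (hχfχ y) (sq_nonneg _)
          linarith
  -- majorant of `(div V♭)²`
  have hdivV : ∀ y, VectorCalculus.divergence Vf y ^ 2 ≤
      (closedBall (0 : EuclideanSpace ℝ (Fin 3)) R).indicator (fun _ => M) y := by
    intro y
    have hind0 : 0 ≤ (closedBall (0 : EuclideanSpace ℝ (Fin 3)) R).indicator (fun _ => M) y :=
      Set.indicator_nonneg (fun _ _ => hM0) _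
    rcases le_or_gt ‖y‖ R with hyR | hyR
    · rw [Set.indicator_of_mem (mem_closedBall_zero_iff.2 hyR)]
      have hdχ : DifferentiableAt ℝ χf y := (hχf3.differentiable (by norm_num)) y
      have hdU : DifferentiableAt ℝ U y := (hU.differentiable (by norm_num)) y
      have hd := divergence_smul_apply (u := U) hdχ hdU
      rw [hVf, hdiv y (by linarith), mul_zero, zero_add] at hd
      rw [hd]
      have hgn : ‖gradient χf y‖ = ‖fderiv ℝ χf y‖ := by
        unfold gradient; exact LinearIsometryEquiv.norm_map _ _
      rcases lt_or_ge ‖y‖ (R / 2) with hy2 | hy2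
      · have h0 : fderiv ℝ χf y = 0 := hDχ0 y (Or.inl hy2)
        have hg0 : gradient χf y = 0 := by unfold gradient; rw [h0, map_zero]
        rw [hg0, inner_zero_right, zero_pow two_ne_zero]
        exact hM0
      · calc ⟪U y, gradient χf y⟫ ^ 2 ≤ (‖U y‖ * ‖gradient χf y‖) ^ 2 := by
              rw [← sq_abs]
              exact pow_le_pow_left₀ (abs_nonneg _) (abs_real_inner_le_norm _ _) 2
          _ ≤ ((2 * C₁ / R) * (2 * Cu / R)) ^ 2 := by
              rw [hgn, mul_comm]
              exact pow_le_pow_left₀ (by positivity) (hann y hy2 hyR) 2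
          _ = M := hM
    · have h0 := (sliceV_fderiv_eq_zero hχb0 hR'0 hχf.symm hVf.symm (y := y) (by rw [h4R']; exact hyR)).1
      rw [divergence_eq_traceCLM, h0, map_zero, zero_pow two_ne_zero]
      exact hind0
  -- integrability
  have hχc : HasCompactSupport χ := by rw [hχ]; exact hasCompactSupport_cutoffScale hχb0 hR0
  have hχcont : Continuous χ := by rw [hχ]; exact hχb.continuous.comp (continuous_const_smul _)
  have iF : Integrable fun y => χ y ^ 2 * ‖curl U y‖ ^ 2 :=
    integrable_cutoff_sq_mul hχc hχcont ((continuous_curl hU1).norm.pow 2)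
  have hDVc : Continuous fun y => fderiv ℝ Vf y := hVf1.continuous_fderiv one_ne_zero
  have hDVs : HasCompactSupport fun y => fderiv ℝ Vf y := hVfc.fderiv ℝ
  have cFr : Continuous fun y => frobeniusNormSq (fderiv ℝ Vf y) :=
    continuous_frobeniusNormSq_fderiv_of_contDiff hVf1
  have sFr : HasCompactSupport fun y => frobeniusNormSq (fderiv ℝ Vf y) :=
    hDVs.comp_left (g := frobeniusNormSq) frobeniusNormSq_zero
  have iFr : Integrable fun y => frobeniusNormSq (fderiv ℝ Vf y) := cFr.integrable_of_hasCompactSupport sFr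
  have ccurl : Continuous fun y => ‖curl Vf y‖ ^ 2 := (continuous_curl hVf1).norm.pow 2
  have scurl0 : HasCompactSupport (curl Vf) := hasCompactSupport_curl hVfc
  have scurl : HasCompactSupport fun y => ‖curl Vf y‖ ^ 2 :=
    scurl0.norm.comp_left (g := fun t : ℝ => t ^ 2) (by simp)
  have icurl : Integrable fun y => ‖curl Vf y‖ ^ 2 := ccurl.integrable_of_hasCompactSupport scurl
  have cdiv : Continuous fun y => VectorCalculus.divergence Vf y := by
    rw [divergence_eq_traceCLM_comp]; exact traceCLM.continuous.comp hDVc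
  have sdiv0 : HasCompactSupport fun y => VectorCalculus.divergence Vf y := by
    rw [divergence_eq_traceCLM_comp]; exact hDVs.comp_left (map_zero _)
  have sdiv : HasCompactSupport fun y => VectorCalculus.divergence Vf y ^ 2 :=
    sdiv0.comp_left (g := fun t : ℝ => t ^ 2) (by simp)
  have idiv : Integrable fun y => VectorCalculus.divergence Vf y ^ 2 :=
    (cdiv.pow 2).integrable_of_hasCompactSupport sdiv
  have iInd : Integrable ((closedBall (0 : EuclideanSpace ℝ (Fin 3)) R).indicator fun _ => κ ^ 2 * M) :=
    integrable_indicator_closedBall_const_fin3 _ _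
  have iInd' : Integrable ((closedBall (0 : EuclideanSpace ℝ (Fin 3)) R).indicator fun _ => M) :=
    integrable_indicator_closedBall_const_fin3 _ _
  have imaj : Integrable fun y => 2 * (χ y ^ 2 * ‖curl U y‖ ^ 2) +
      2 * (closedBall (0 : EuclideanSpace ℝ (Fin 3)) R).indicator (fun _ => κ ^ 2 * M) y :=
    (iF.const_mul 2).add (iInd.const_mul 2)
  -- the integral bounds
  obtain ⟨vol, hvol⟩ : ∃ v : ℝ, (volume (closedBall (0 : EuclideanSpace ℝ (Fin 3)) R)).toReal = v := ⟨_, rfl⟩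
  have b1 : ∫ y, ‖curl Vf y‖ ^ 2 ≤ 2 * (θ ^ 2 / 4) + 2 * (κ ^ 2 * M * vol) := by
    have h := integral_mono icurl imaj hcurl
    have e : ∫ y, (2 * (χ y ^ 2 * ‖curl U y‖ ^ 2) +
        2 * (closedBall (0 : EuclideanSpace ℝ (Fin 3)) R).indicator (fun _ => κ ^ 2 * M) y) =
        2 * (∫ y, χ y ^ 2 * ‖curl U y‖ ^ 2) + 2 * (κ ^ 2 * M * vol) := by
      have i1 : Integrable fun y => 2 * (χ y ^ 2 * ‖curl U y‖ ^ 2) := iF.const_mul 2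
      have i2 : Integrable fun y => 2 * (closedBall (0 : EuclideanSpace ℝ (Fin 3)) R).indicator
          (fun _ => κ ^ 2 * M) y := iInd.const_mul 2
      rw [integral_add i1 i2, integral_const_mul, integral_const_mul, integral_indicator_closedBall_const, hvol]
    rw [e] at h
    nlinarith
  have b2 : ∫ y, VectorCalculus.divergence Vf y ^ 2 ≤ M * vol := by
    have h := integral_mono idiv iInd' hdivV
    rwa [integral_indicator_closedBall_const, hvol] at h
  have b3 : ∫ y, frobeniusNormSq (fderiv ℝ Vf y) ≤ 2 * θ ^ 2 := by
    rw [integral_frobeniusNormSq_fderiv_eq_of_hasCompactSupport hVf2 hVfc]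
    rw [hM, hvol] at hsmall
    nlinarith [b1, b2, hsmall, sq_nonneg θ, sq_nonneg κ, mul_nonneg hM0 (show (0:ℝ) ≤ vol by rw [← hvol]; exact ENNReal.toReal_nonneg)]
  -- from `V♭` back to `U` on `B(0, R/2)`
  have hDU : ∀ y ∈ ball (0 : EuclideanSpace ℝ (Fin 3)) (R / 2), fderiv ℝ U y = fderiv ℝ Vf y := by
    intro y hy
    have h := sliceV_eventuallyEq hχb1 hR'0 hχf.symm hVf.symm (y := y)
      (by rw [h2R']; exact mem_ball_zero_iff.1 hy)
    exact h.fderiv_eq.symm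
  have c1 : ∫⁻ y in ball (0 : EuclideanSpace ℝ (Fin 3)) (R / 2), ENNReal.ofReal (frobeniusNormSq (fderiv ℝ U y)) =
      ∫⁻ y in ball (0 : EuclideanSpace ℝ (Fin 3)) (R / 2), ENNReal.ofReal (frobeniusNormSq (fderiv ℝ Vf y)) :=
    setLIntegral_congr_fun measurableSet_ball fun y hy => by rw [hDU y hy]
  have c2 : ∫⁻ y in ball (0 : EuclideanSpace ℝ (Fin 3)) (R / 2), ENNReal.ofReal (frobeniusNormSq (fderiv ℝ Vf y)) ≤
      ∫⁻ y, ENNReal.ofReal (frobeniusNormSq (fderiv ℝ Vf y)) :=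
    setLIntegral_le_lintegral (ball (0 : EuclideanSpace ℝ (Fin 3)) (R / 2))
      (fun y => ENNReal.ofReal (frobeniusNormSq (fderiv ℝ Vf y)))
  have c3 : ∫⁻ y, ENNReal.ofReal (frobeniusNormSq (fderiv ℝ Vf y)) =
      ENNReal.ofReal (∫ y, frobeniusNormSq (fderiv ℝ Vf y)) :=
    (ofReal_integral_eq_lintegral_ofReal iFr (Eventually.of_forall fun y => frobeniusNormSq_nonneg _)).symm
  rw [c1]
  refine c2.trans ?_
  rw [c3]
  exact ENNReal.ofReal_le_ofReal b3

end InitialAndFinal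


section MainPropagation

-- nested operator types
set_option maxSynthPendingDepth 3

variable {u : ℝ → EuclideanSpace ℝ (Fin 3) → EuclideanSpace ℝ (Fin 3)}
  {p : ℝ → EuclideanSpace ℝ (Fin 3) → ℝ} {ζ : EuclideanSpace ℝ (Fin 3) → ℝ}
  {ut : ℝ → EuclideanSpace ℝ (Fin 3) → EuclideanSpace ℝ (Fin 3)}
  {U : EuclideanSpace ℝ (Fin 3) → EuclideanSpace ℝ (Fin 3)}
  {χb χ η : EuclideanSpace ℝ (Fin 3) → ℝ} {ψ : ℝ → EuclideanSpace ℝ (Fin 3) → ℝ}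
  {s c R T₁ : ℝ}

set_option maxHeartbeats 1600000 in
/-- **The enstrophy identity in similarity variables** (Pineau–Vicol (9.9)):
`(−s) d/ds ∫ψ|curl ũ|² = −½F² + E − 2D² + S` for the profile `U(y) = √(−s) ũ(s, √(−s)y)`,
in the notation of `slice_enstrophy_ineq`. [cite: PineauVicol2026, (9.9), arXiv:2607.09619 p. 31] -/
theorem hasDerivAt_weightedEnstrophy_similarity
    (hreg : IsClassicalNSSolutionOnRegion
      (Ico (-1 : ℝ) 0 ×ˢ ball (0 : EuclideanSpace ℝ (Fin 3)) 1) 1 0 u p)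
    (hζ : ContDiff ℝ ∞ ζ) (hζs : tsupport ζ ⊆ ball (0 : EuclideanSpace ℝ (Fin 3)) 1)
    (hζ1 : ∀ x ∈ ball (0 : EuclideanSpace ℝ (Fin 3)) (1 / 2), ζ =ᶠ[𝓝 x] fun _ => (1 : ℝ))
    (hut : ut = fun t x => ζ x • u t x)
    (hχb : ContDiff ℝ ∞ χb) (hχb0 : ∀ x, 2 ≤ ‖x‖ → χb x = 0) (hR : 0 < R)
    (hχ : χ = fun y => χb (R⁻¹ • y)) (hη : η = fun y => χb (R⁻¹ • y) ^ 2)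
    (hψ : ψ = fun t x => Real.sqrt (-t) * η ((Real.sqrt (-t))⁻¹ • x))
    (hT₁ : T₁ ≤ 1) (hRT : 2 * R * Real.sqrt T₁ ≤ 1 / 2)
    (hs : s ∈ Ioo (-T₁) 0) (hcs : Real.sqrt (-s) = c) (hU : U = fun y => c • ut s (c • y)) :
    HasDerivAt (fun s => ∫ x, ψ s x * ‖curl (ut s) x‖ ^ 2)
      (c⁻¹ ^ 2 * (-(1 / 2) * (∫ y, χ y ^ 2 * ‖curl U y‖ ^ 2) +
          (∫ y, (1 / 2 * fderiv ℝ η y y + (Δ η) y + fderiv ℝ η y (U y)) * ‖curl U y‖ ^ 2) -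
          2 * (∫ y, χ y ^ 2 * frobeniusNormSq (fderiv ℝ (curl U) y)) +
          2 * (∫ y, χ y ^ 2 * ⟪curl U y, fderiv ℝ U y (curl U y)⟫))) s := by
  have hc : 0 < c := by rw [← hcs]; exact Real.sqrt_pos.2 (by linarith [hs.2])
  have hc0 : c ≠ 0 := hc.ne'
  have h := hasDerivAt_weightedEnstrophy hreg hζ hζs hζ1 hut hχb hχb0 hR hη hψ hT₁ hRT hs
  rw [hcs] at h
  refine h.congr_deriv ?_
  -- the slice weight
  have hηs : ContDiff ℝ ∞ η := by rw [hη]; exact (hχb.comp (contDiff_const_smul _)).pow 2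
  have hη2 : ContDiff ℝ 2 η := hηs.of_le (by norm_cast)
  have hψs : ψ s = fun x => c * η (c⁻¹ • x) := by rw [hψ]; funext x; simp only [hcs]
  have eΔ : ∀ x, (Δ (ψ s)) x = c⁻¹ * (Δ η) (c⁻¹ • x) := fun x => by
    rw [hψs]; exact laplacian_selfSimilarWeight hη2 hc0 x
  have eD : ∀ x, fderiv ℝ (ψ s) x = fderiv ℝ η (c⁻¹ • x) := fun x => by
    rw [hψs]; exact fderiv_selfSimilarWeight hc0 x
  have eψ : ∀ x, ψ s x = c * η (c⁻¹ • x) := fun x => by rw [hψs]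
  simp_rw [eΔ, eD, eψ]
  -- the four substitutions
  rw [integral_weightDeriv_mul_sq_norm_curl_eq (η := η) hc hU,
    integral_weight_mul_frobeniusNormSq_eq (η := η) hc hU,
    integral_weight_mul_stretch_eq (η := η) hc hU]
  -- `η = χ²`
  have e1 : ∫ y, (-(1 / 2) * η y + 1 / 2 * fderiv ℝ η y y + (Δ η) y + fderiv ℝ η y (U y)) * ‖curl U y‖ ^ 2 =
      -(1 / 2) * (∫ y, χ y ^ 2 * ‖curl U y‖ ^ 2) +
        ∫ y, (1 / 2 * fderiv ℝ η y y + (Δ η) y + fderiv ℝ η y (U y)) * ‖curl U y‖ ^ 2 := by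
    -- both integrands are continuous with compact support
    have hU3 : ContDiff ℝ 3 U := profileAt_contDiff hreg hζ hζs hut ⟨by linarith [hs.1], hs.2⟩ hU
    have hU1 : ContDiff ℝ 1 U := hU3.of_le (by norm_num)
    have hNc : Continuous fun y => ‖curl U y‖ ^ 2 := (continuous_curl hU1).norm.pow 2
    have hηc : HasCompactSupport η := by
      refine HasCompactSupport.intro (isCompact_closedBall (0 : EuclideanSpace ℝ (Fin 3)) (2 * R))
        fun y hy => ?_
      rw [mem_closedBall_zero_iff, not_le] at hy
      exact (eta_eventuallyEq_zero hχb0 hR hη hy).self_of_nhds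
    have hηcont : Continuous η := hηs.continuous
    have i1 : Integrable fun y => (-(1 / 2) * η y) * ‖curl U y‖ ^ 2 := by
      have hc1 : Continuous fun y => -(1 / 2) * η y := continuous_const.mul hηcont
      have hs1 : HasCompactSupport fun y => -(1 / 2) * η y := hηc.mul_left
      have this : Integrable fun y => ‖curl U y‖ ^ 2 * (-(1 / 2) * η y) :=
        integrable_mul_of_continuous_of_hasCompactSupport hNc hc1 hs1
      exact this.congr (Eventually.of_forall fun y => by simp only; ring)
    have hrest_c : Continuous fun y => 1 / 2 * fderiv ℝ η y y + (Δ η) y + fderiv ℝ η y (U y) := by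
      have hD : Continuous fun y => fderiv ℝ η y := hηs.continuous_fderiv (by simp)
      exact ((continuous_const.mul (hD.clm_apply continuous_id)).add (continuous_laplacian hη2)).add
        (hD.clm_apply hU3.continuous)
    have hrest_s : HasCompactSupport fun y => 1 / 2 * fderiv ℝ η y y + (Δ η) y + fderiv ℝ η y (U y) := by
      refine HasCompactSupport.intro (isCompact_closedBall (0 : EuclideanSpace ℝ (Fin 3)) (2 * R))
        fun y hy => ?_
      rw [mem_closedBall_zero_iff, not_le] at hy
      have h0 := eta_eventuallyEq_zero hχb0 hR hη hy
      have hDy : fderiv ℝ η y = 0 := by rw [h0.fderiv_eq, fderiv_const_apply]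
      have hLy : (Δ η) y = 0 := by
        rw [(InnerProductSpace.laplacian_congr_nhds h0).eq_of_nhds, InnerProductSpace.laplacian_const]; rfl
      rw [hDy, hLy]; simp
    have i2 : Integrable fun y => (1 / 2 * fderiv ℝ η y y + (Δ η) y + fderiv ℝ η y (U y)) * ‖curl U y‖ ^ 2 := by
      have this : Integrable fun y => ‖curl U y‖ ^ 2 * (1 / 2 * fderiv ℝ η y y + (Δ η) y + fderiv ℝ η y (U y)) :=
        integrable_mul_of_continuous_of_hasCompactSupport hNc hrest_c hrest_s
      exact this.congr (Eventually.of_forall fun y => by simp only; ring)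
    have esplit : ∀ y, (-(1 / 2) * η y + 1 / 2 * fderiv ℝ η y y + (Δ η) y + fderiv ℝ η y (U y)) * ‖curl U y‖ ^ 2 =
        (-(1 / 2) * η y) * ‖curl U y‖ ^ 2 +
          (1 / 2 * fderiv ℝ η y y + (Δ η) y + fderiv ℝ η y (U y)) * ‖curl U y‖ ^ 2 := fun y => by ring
    simp_rw [esplit]
    rw [integral_add i1 i2]
    have e3 : ∫ y, (-(1 / 2) * η y) * ‖curl U y‖ ^ 2 = -(1 / 2) * ∫ y, χ y ^ 2 * ‖curl U y‖ ^ 2 := by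
      rw [← integral_const_mul]
      refine integral_congr_ae (Eventually.of_forall fun y => ?_)
      simp only [hη, hχ]; ring
    rw [e3]
  have e4 : ∫ y, η y * frobeniusNormSq (fderiv ℝ (curl U) y) = ∫ y, χ y ^ 2 * frobeniusNormSq (fderiv ℝ (curl U) y) :=
    integral_congr_ae (Eventually.of_forall fun y => by simp only [hη, hχ])
  have e5 : ∫ y, η y * ⟪curl U y, fderiv ℝ U y (curl U y)⟫ = ∫ y, χ y ^ 2 * ⟪curl U y, fderiv ℝ U y (curl U y)⟫ :=
    integral_congr_ae (Eventually.of_forall fun y => by simp only [hη, hχ])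
  rw [e1, e4, e5]
  ring

end MainPropagation


section PhysicalConversion

-- nested operator types
set_option maxSynthPendingDepth 3

variable {u : ℝ → EuclideanSpace ℝ (Fin 3) → EuclideanSpace ℝ (Fin 3)}
  {ζ : EuclideanSpace ℝ (Fin 3) → ℝ}
  {ut : ℝ → EuclideanSpace ℝ (Fin 3) → EuclideanSpace ℝ (Fin 3)}
  {U : EuclideanSpace ℝ (Fin 3) → EuclideanSpace ℝ (Fin 3)} {t c R : ℝ}

/-- **Back to physical variables**: `∫_{B(0, ½R√(−t))} |Du(t)|²_F dx = (−t)^{-1/2} ∫_{B(0,R/2)} |DU|²_F dy`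
for the profile `U(y) = √(−t) ũ(t, √(−t) y)` (`ũ = u` on the plateau), whence the bound. [folklore] -/
theorem setLIntegral_frobeniusNormSq_physical_le
    (hζ1 : ∀ x ∈ ball (0 : EuclideanSpace ℝ (Fin 3)) (1 / 2), ζ =ᶠ[𝓝 x] fun _ => (1 : ℝ))
    (hut : ut = fun t x => ζ x • u t x) (hc : 0 < c)
    (hU : U = fun y => c • ut t (c • y)) (hRc : R / 2 * c < 1 / 2) (hR : 0 < R) {B : ℝ≥0∞}
    (hB : ∫⁻ y in ball (0 : EuclideanSpace ℝ (Fin 3)) (R / 2), ENNReal.ofReal (frobeniusNormSq (fderiv ℝ U y)) ≤ B) :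
    ∫⁻ x in ball (0 : EuclideanSpace ℝ (Fin 3)) (R / 2 * c), ENNReal.ofReal (frobeniusNormSq (fderiv ℝ (u t) x)) ≤
      ENNReal.ofReal c⁻¹ * B := by
  have hc0 : c ≠ 0 := hc.ne'
  -- `frob(Du(t))(c y) = c⁻⁴ frob(DU)(y)` on `B(0, R/2)`
  have hpt : ∀ y ∈ ball (0 : EuclideanSpace ℝ (Fin 3)) (R / 2),
      ENNReal.ofReal (frobeniusNormSq (fderiv ℝ (u t) ((0 : EuclideanSpace ℝ (Fin 3)) + c • y))) =
        ENNReal.ofReal (c⁻¹ ^ 4) * ENNReal.ofReal (frobeniusNormSq (fderiv ℝ U y)) := by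
    intro y hy
    rw [zero_add]
    have hcy : c • y ∈ ball (0 : EuclideanSpace ℝ (Fin 3)) (1 / 2) := by
      rw [mem_ball_zero_iff, norm_smul, Real.norm_of_nonneg hc.le]
      rw [mem_ball_zero_iff] at hy
      nlinarith
    have hutu : ut t =ᶠ[𝓝 (c • y)] u t := by rw [hut]; exact cutoff_smul_slice_eventuallyEq (hζ1 _ hcy) t
    have hDU : fderiv ℝ U y = c ^ 2 • fderiv ℝ (u t) (c • y) := by
      rw [hU, fderiv_smul_comp_smul, hutu.fderiv_eq]
    have hfr : frobeniusNormSq (fderiv ℝ (u t) (c • y)) = c⁻¹ ^ 4 * frobeniusNormSq (fderiv ℝ U y) := by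
      rw [hDU, frobeniusNormSq_const_smul_fin3]
      field_simp
    rw [hfr, ENNReal.ofReal_mul (by positivity)]
  -- substitution `x = c y`
  have hsub := setLIntegral_preimage_comp_space_affine hc (0 : EuclideanSpace ℝ (Fin 3))
    (fun x => ENNReal.ofReal (frobeniusNormSq (fderiv ℝ (u t) x)))
    (ball (0 : EuclideanSpace ℝ (Fin 3)) (R / 2 * c))
  rw [space_affine_preimage_ball hc, sub_zero, smul_zero, show R / 2 * c / c = R / 2 by field_simp,
    finrank_euclideanSpace_fin] at hsub
  rw [setLIntegral_congr_fun measurableSet_ball hpt, lintegral_const_mul' _ _ ENNReal.ofReal_ne_top] at hsub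
  -- solve for the physical integral
  have key : ∫⁻ x in ball (0 : EuclideanSpace ℝ (Fin 3)) (R / 2 * c), ENNReal.ofReal (frobeniusNormSq (fderiv ℝ (u t) x)) =
      ENNReal.ofReal (c ^ 3) * (ENNReal.ofReal (c⁻¹ ^ 4) *
        ∫⁻ y in ball (0 : EuclideanSpace ℝ (Fin 3)) (R / 2), ENNReal.ofReal (frobeniusNormSq (fderiv ℝ U y))) := by
    rw [hsub, ← mul_assoc, ← ENNReal.ofReal_mul (by positivity), mul_inv_cancel₀ (pow_ne_zero 3 hc0),
      ENNReal.ofReal_one, one_mul]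
  rw [key, ← mul_assoc, ← ENNReal.ofReal_mul (by positivity),
    show c ^ 3 * c⁻¹ ^ 4 = c⁻¹ by field_simp]
  exact mul_le_mul_right hB _

end PhysicalConversion


section MainTheorem

-- nested operator types
set_option maxSynthPendingDepth 3

set_option maxHeartbeats 3200000 in
/-- **Pineau–Vicol, Lemma 9.4 (propagation of small vorticity), in physical variables** — the
input `hA` of the reduction `pineauVicol2026_oneSlice_regularity_of_core'` of Theorem 1.9: there
is a universal `ϑ > 0` such that for `θ ≤ ϑ` and Type I constants `C_u, K, K₂` there is
`R₀ ≥ 2` such that for `R ≥ R₀` and every scale `c₁ > 0` there is `T₀ ∈ (0, 1]` with: for a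
classical solution on `[-1,0) × B₁` (`ν = 1`, `f = 0`) with the Type I bound (1.15) and the
gradient bounds of orders `1, 2` at scales `|x| + √(−t) ≤ c₁`, if at some `t̄ ∈ (−T₀, 0)`
`∫_{B(2R√(−t̄))} |ω(t̄)|² ≤ θ²/(4√(−t̄))`, then for all `t ∈ [t̄, 0)`,
`∫_{B(½R√(−t))} |∇u(t)|²_F ≤ 4θ²/√(−t)`. Proof: the weighted enstrophy
`G(s) = ∫ψ(s)|curl ũ(s)|²` (`PineauVicolEnstrophyIdentity`) satisfies `G(t̄) ≤ θ²/4`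
(`weightedEnstrophy_le_of_setLIntegral_le`), the differential inequality
`(−s)G' ≤ θ²/16 − G/4` while `G ≤ θ²` (`hasDerivAt_weightedEnstrophy_similarity` and
`slice_enstrophy_ineq` for the profile at time `s`, whose Type I bounds are `profileAt_bounds`),
hence `G ≤ θ²/4` on `[t̄, 0)` (`le_of_deriv_barrier`), and the `L²` div–curl step
(`setLIntegral_frobeniusNormSq_profile_le`, `setLIntegral_frobeniusNormSq_physical_le`) gives the
gradient bound. [cite: PineauVicol2026, Lemma 9.4, arXiv:2607.09619 pp. 31–32] -/
theorem pineauVicol_smallVorticity_propagation :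
    ∃ ϑ : ℝ, 0 < ϑ ∧ ∀ θ : ℝ, 0 < θ → θ ≤ ϑ → ∀ Cu K K₂ : ℝ, ∃ R₀ : ℝ, 2 ≤ R₀ ∧
      ∀ R : ℝ, R₀ ≤ R → ∀ c₁ : ℝ, 0 < c₁ → ∃ T₀ : ℝ, 0 < T₀ ∧ T₀ ≤ 1 ∧
      ∀ (u : ℝ → EuclideanSpace ℝ (Fin 3) → EuclideanSpace ℝ (Fin 3))
        (p : ℝ → EuclideanSpace ℝ (Fin 3) → ℝ),
        IsClassicalNSSolutionOnRegion
          (Ico (-1 : ℝ) 0 ×ˢ ball (0 : EuclideanSpace ℝ (Fin 3)) 1) 1 0 u p →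
        (∀ t ∈ Ico (-1 : ℝ) 0, ∀ x ∈ ball (0 : EuclideanSpace ℝ (Fin 3)) 1,
          ‖u t x‖ ≤ Cu / (Real.sqrt (-t) + ‖x‖)) →
        (∀ t ∈ Ioo (-1 : ℝ) 0, ∀ x : EuclideanSpace ℝ (Fin 3), ‖x‖ + Real.sqrt (-t) ≤ c₁ →
          ‖fderiv ℝ (u t) x‖ ≤ K / (‖x‖ + Real.sqrt (-t)) ^ 2) →
        (∀ t ∈ Ioo (-1 : ℝ) 0, ∀ x : EuclideanSpace ℝ (Fin 3), ‖x‖ + Real.sqrt (-t) ≤ c₁ →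
          ‖iteratedFDeriv ℝ 2 (u t) x‖ ≤ K₂ / (‖x‖ + Real.sqrt (-t)) ^ 3) →
        ∀ tb ∈ Ioo (-T₀) 0,
          (∫⁻ x in ball (0 : EuclideanSpace ℝ (Fin 3)) (2 * R * Real.sqrt (-tb)),
              ENNReal.ofReal (‖curl (u tb) x‖ ^ 2) ≤
            ENNReal.ofReal (θ ^ 2 / (4 * Real.sqrt (-tb)))) →
          ∀ t ∈ Ico tb 0,
            ∫⁻ x in ball (0 : EuclideanSpace ℝ (Fin 3)) (R / 2 * Real.sqrt (-t)),
                ENNReal.ofReal (frobeniusNormSq (fderiv ℝ (u t) x)) ≤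
              ENNReal.ofReal (4 * θ ^ 2 / Real.sqrt (-t)) := by
  -- the universal cut-off `χ̄` and its constants
  let χbb : ContDiffBump (0 : EuclideanSpace ℝ (Fin 3)) := ⟨1, 2, one_pos, one_lt_two⟩
  obtain ⟨χb, hχbdef⟩ : ∃ χb : EuclideanSpace ℝ (Fin 3) → ℝ, ⇑χbb = χb := ⟨_, rfl⟩
  have hχb : ContDiff ℝ ∞ χb := by rw [← hχbdef]; exact χbb.contDiff
  have hχb3 : ContDiff ℝ 3 χb := hχb.of_le (by norm_cast)
  have hχb1 : ∀ x : EuclideanSpace ℝ (Fin 3), ‖x‖ ≤ 1 → χb x = 1 := fun x hx => by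
    rw [← hχbdef]; exact χbb.one_of_mem_closedBall (by simpa using hx)
  have hχb0 : ∀ x : EuclideanSpace ℝ (Fin 3), 2 ≤ ‖x‖ → χb x = 0 := fun x hx => by
    rw [← hχbdef]; exact χbb.zero_of_le_dist (by simpa using hx)
  have hχb01 : ∀ x, |χb x| ≤ 1 := fun x => by
    rw [← hχbdef]; exact abs_le.2 ⟨by linarith [χbb.nonneg (x := x)], χbb.le_one⟩
  have hχbc : HasCompactSupport χb := by rw [← hχbdef]; exact χbb.hasCompactSupport
  obtain ⟨C₁, hC₁⟩ := (hχbc.fderiv ℝ).exists_bound_of_continuous (hχb.continuous_fderiv (by simp))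
  obtain ⟨C₂, hC₂⟩ := (hχbc.iteratedFDeriv 2).exists_bound_of_continuous
    (hχb3.continuous_iteratedFDeriv (m := 2) (by norm_num))
  have hC₁0 : 0 ≤ C₁ := (norm_nonneg _).trans (hC₁ 0)
  have hC₂0 : 0 ≤ C₂ := (norm_nonneg _).trans (hC₂ 0)
  -- the slice inequality
  obtain ⟨ϑ, hϑ, -, HS⟩ := slice_enstrophy_ineq
  refine ⟨ϑ, hϑ, ?_⟩
  intro θ hθ hθϑ Cu K K₂
  set Cu' : ℝ := max Cu 0 with hCu'
  set K' : ℝ := max K 0 with hK'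
  set K₂' : ℝ := max K₂ 0 with hK₂'
  have hCu'0 : 0 ≤ Cu' := le_max_right _ _
  have hK'0 : 0 ≤ K' := le_max_right _ _
  have hK₂'0 : 0 ≤ K₂' := le_max_right _ _
  obtain ⟨R₁, hR₁1, HR⟩ := HS θ hθ hθϑ Cu' K' K₂' C₁ C₂ hCu'0 hK'0 hK₂'0 hC₁0 hC₂0
  -- the size of `R` needed by the final div–curl step
  obtain ⟨κ, hκ⟩ : ∃ κ : ℝ, ‖curlCLM‖ = κ := ⟨_, rfl⟩
  obtain ⟨v₁, hv₁⟩ : ∃ v : ℝ, (volume (ball (0 : EuclideanSpace ℝ (Fin 3)) 1)).toReal = v := ⟨_, rfl⟩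
  have hv₁0 : 0 ≤ v₁ := by rw [← hv₁]; exact ENNReal.toReal_nonneg
  set R₂ : ℝ := 16 * (2 * κ ^ 2 + 1) * C₁ ^ 2 * Cu' ^ 2 * v₁ / θ ^ 2 with hR₂
  have hR₂0 : 0 ≤ R₂ := by positivity
  refine ⟨max 4 (max R₁ R₂), le_trans (by norm_num) (le_max_left _ _), ?_⟩
  intro R hR c₁ hc₁
  have hR4 : 4 ≤ R := (le_max_left _ _).trans hR
  have hRR₁ : R₁ ≤ R := ((le_max_left _ _).trans (le_max_right _ _)).trans hR
  have hRR₂ : R₂ ≤ R := ((le_max_right _ _).trans (le_max_right _ _)).trans hR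
  have hR0 : 0 < R := by linarith
  have hR1 : 1 ≤ R := by linarith
  -- the time `T₀ = m²`
  set m : ℝ := min (1 / 2) (min (1 / (12 * R)) (c₁ / (4 * R + 2))) with hm
  have hm0 : 0 < m := lt_min (by norm_num) (lt_min (by positivity) (by positivity))
  have hm1 : m ≤ 1 / 2 := min_le_left _ _
  have hm2 : m ≤ 1 / (12 * R) := (min_le_right _ _).trans (min_le_left _ _)
  have hm3 : m ≤ c₁ / (4 * R + 2) := (min_le_right _ _).trans (min_le_right _ _)
  have hsqm : Real.sqrt (m ^ 2) = m := Real.sqrt_sq hm0.le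
  refine ⟨m ^ 2, by positivity, by nlinarith, ?_⟩
  intro u p hreg hI hK hK₂ tb htb Htb t ht
  -- scales at times `s ∈ (−m², 0)`
  have hscale : ∀ s ∈ Ioo (-(m ^ 2)) 0, s ∈ Ioo (-1 : ℝ) 0 ∧ 0 < Real.sqrt (-s) ∧
      5 * R * Real.sqrt (-s) < 1 / 2 ∧ 4 * R * Real.sqrt (-s) < 1 / 2 ∧ 2 * R * Real.sqrt (-s) < 1 / 2 ∧
      R / 2 * Real.sqrt (-s) < 1 / 2 ∧ Real.sqrt (-s) * (1 + 4 * R) ≤ c₁ := by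
    intro s hs
    have hc : 0 < Real.sqrt (-s) := Real.sqrt_pos.2 (by linarith [hs.2])
    have hcm : Real.sqrt (-s) < m := by
      have := Real.sqrt_lt_sqrt (by linarith [hs.2]) (show -s < m ^ 2 by linarith [hs.1])
      rwa [hsqm] at this
    have h12 : 12 * R * Real.sqrt (-s) < 1 := by
      have h1 : 12 * R * Real.sqrt (-s) < 12 * R * m := by nlinarith
      have h2 : 12 * R * m ≤ 1 := by
        calc 12 * R * m ≤ 12 * R * (1 / (12 * R)) := mul_le_mul_of_nonneg_left hm2 (by positivity)
          _ = 1 := by field_simp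
      linarith
    have hc₁' : Real.sqrt (-s) * (1 + 4 * R) ≤ c₁ := by
      have h1 : Real.sqrt (-s) * (4 * R + 2) ≤ m * (4 * R + 2) := by nlinarith
      have h2 : m * (4 * R + 2) ≤ c₁ := by
        have := mul_le_mul_of_nonneg_right hm3 (by positivity : (0 : ℝ) ≤ 4 * R + 2)
        rwa [div_mul_cancel₀ _ (by positivity : (4 : ℝ) * R + 2 ≠ 0)] at this
      nlinarith
    refine ⟨⟨by nlinarith [hs.1], hs.2⟩, hc, by nlinarith, by nlinarith, by nlinarith, by nlinarith, hc₁'⟩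
  have hRT : 2 * R * Real.sqrt (m ^ 2) ≤ 1 / 2 := by
    rw [hsqm]
    have := mul_le_mul_of_nonneg_left hm2 (by positivity : (0 : ℝ) ≤ 2 * R)
    have e : 2 * R * (1 / (12 * R)) = 1 / 6 := by field_simp; ring
    linarith
  have hT1 : m ^ 2 ≤ 1 := by nlinarith
  -- the cut-off `ζ` and the cut-off field
  let ζbb : ContDiffBump (0 : EuclideanSpace ℝ (Fin 3)) := ⟨1 / 2, 3 / 4, by norm_num, by norm_num⟩
  obtain ⟨ζ, hζdef⟩ : ∃ ζ : EuclideanSpace ℝ (Fin 3) → ℝ, ⇑ζbb = ζ := ⟨_, rfl⟩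
  have hζ : ContDiff ℝ ∞ ζ := by rw [← hζdef]; exact ζbb.contDiff
  have hζs : tsupport ζ ⊆ ball (0 : EuclideanSpace ℝ (Fin 3)) 1 := by
    rw [← hζdef, ζbb.tsupport_eq]; exact closedBall_subset_ball (by norm_num)
  have hζ1 : ∀ x ∈ ball (0 : EuclideanSpace ℝ (Fin 3)) (1 / 2), ζ =ᶠ[𝓝 x] fun _ => (1 : ℝ) :=
    fun x hx => by
      have h := ζbb.eventuallyEq_one_of_mem_ball hx
      rw [hζdef] at h
      exact h.mono fun z hz => by simpa using hz
  obtain ⟨ut, hut⟩ : ∃ ut : ℝ → EuclideanSpace ℝ (Fin 3) → EuclideanSpace ℝ (Fin 3),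
      ut = fun t x => ζ x • u t x := ⟨_, rfl⟩
  obtain ⟨χ, hχ⟩ : ∃ χ : EuclideanSpace ℝ (Fin 3) → ℝ, χ = fun y => χb (R⁻¹ • y) := ⟨_, rfl⟩
  obtain ⟨η, hη⟩ : ∃ η : EuclideanSpace ℝ (Fin 3) → ℝ, η = fun y => χb (R⁻¹ • y) ^ 2 := ⟨_, rfl⟩
  obtain ⟨ψ, hψ⟩ : ∃ ψ : ℝ → EuclideanSpace ℝ (Fin 3) → ℝ,
      ψ = fun t x => Real.sqrt (-t) * η ((Real.sqrt (-t))⁻¹ • x) := ⟨_, rfl⟩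
  have hηχ : η = fun y => χ y ^ 2 := by rw [hη, hχ]
  -- the weighted enstrophy
  obtain ⟨G, hG⟩ : ∃ G : ℝ → ℝ, (fun s => ∫ x, ψ s x * ‖curl (ut s) x‖ ^ 2) = G := ⟨_, rfl⟩
  -- Type I bounds with the nonnegative constants
  have hI' : ∀ t ∈ Ico (-1 : ℝ) 0, ∀ x ∈ ball (0 : EuclideanSpace ℝ (Fin 3)) 1,
      ‖u t x‖ ≤ Cu' / (Real.sqrt (-t) + ‖x‖) := fun t ht x hx =>
    (hI t ht x hx).trans (div_le_div_of_nonneg_right (le_max_left _ _) (by positivity))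
  have hK' : ∀ t ∈ Ioo (-1 : ℝ) 0, ∀ x : EuclideanSpace ℝ (Fin 3), ‖x‖ + Real.sqrt (-t) ≤ c₁ →
      ‖fderiv ℝ (u t) x‖ ≤ K' / (‖x‖ + Real.sqrt (-t)) ^ 2 := fun t ht x hx =>
    (hK t ht x hx).trans (div_le_div_of_nonneg_right (le_max_left _ _) (by positivity))
  have hK₂'' : ∀ t ∈ Ioo (-1 : ℝ) 0, ∀ x : EuclideanSpace ℝ (Fin 3), ‖x‖ + Real.sqrt (-t) ≤ c₁ →
      ‖iteratedFDeriv ℝ 2 (u t) x‖ ≤ K₂' / (‖x‖ + Real.sqrt (-t)) ^ 3 := fun t ht x hx =>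
    (hK₂ t ht x hx).trans (div_le_div_of_nonneg_right (le_max_left _ _) (by positivity))
  -- the derivative of `G` in similarity form and the slice inequality
  have hstep : ∀ s ∈ Ioo (-(m ^ 2)) 0, ∃ g : ℝ, HasDerivAt G g s ∧
      (G s ≤ θ ^ 2 → g * (-s) ≤ θ ^ 2 / 16 - G s / 4) := by
    intro s hs
    obtain ⟨hs1, hc, h5, h4, -, -, hcc₁⟩ := hscale s hs
    obtain ⟨c, hcs⟩ : ∃ c : ℝ, Real.sqrt (-s) = c := ⟨_, rfl⟩
    rw [hcs] at hc h5 h4 hcc₁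
    obtain ⟨U, hU⟩ : ∃ U : EuclideanSpace ℝ (Fin 3) → EuclideanSpace ℝ (Fin 3), U = fun y => c • ut s (c • y) :=
      ⟨_, rfl⟩
    have hD := hasDerivAt_weightedEnstrophy_similarity hreg hζ hζs hζ1 hut hχb hχb0 hR0 hχ hη hψ hT1 hRT hs hcs hU
    rw [hG] at hD
    have hGs : G s = ∫ y, χ y ^ 2 * ‖curl U y‖ ^ 2 := by
      rw [← hG]
      exact weightedEnstrophy_eq_profile hcs hs.2 hχ hη hψ hU
    refine ⟨_, hD, fun hGθ => ?_⟩
    -- the slice inequality for the profile at time `s`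
    have hU3 : ContDiff ℝ 3 U := profileAt_contDiff hreg hζ hζs hut hs1 hU
    have hdivU : ∀ y : EuclideanSpace ℝ (Fin 3), ‖y‖ < 5 * R → VectorCalculus.divergence U y = 0 :=
      fun y hy => profileAt_divergence_eq_zero hreg hζ1 hut hs1 hc h5 hU hy
    have hbds : ∀ y : EuclideanSpace ℝ (Fin 3), ‖y‖ ≤ 4 * R →
        ‖U y‖ ≤ Cu' / (1 + ‖y‖) ∧ ‖fderiv ℝ U y‖ ≤ K' / (1 + ‖y‖) ^ 2 ∧
          ‖iteratedFDeriv ℝ 2 U y‖ ≤ K₂' / (1 + ‖y‖) ^ 3 := fun y hy =>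
      profileAt_bounds hreg hI' hK' hK₂'' hζ hζs hζ1 hut hs1 hcs h4 hcc₁ hU hy
    have hF2 : ∫ y, χ y ^ 2 * ‖curl U y‖ ^ 2 ≤ θ ^ 2 := by rw [← hGs]; exact hGθ
    have hslice := HR R hRR₁ χb U χ η hχb3 hχb1 hχb0 hχb01 hC₁ hC₂ hU3 hdivU
      (fun y hy => (hbds y hy).1) (fun y hy => (hbds y hy).2.1) (fun y hy => (hbds y hy).2.2) hχ hηχ hF2
    have hcs2 : c⁻¹ ^ 2 * -s = 1 := by
      have : c ^ 2 = -s := by rw [← hcs]; exact Real.sq_sqrt (by linarith [hs.2])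
      rw [← this]; field_simp
    rw [hGs]
    calc c⁻¹ ^ 2 * (-(1 / 2) * (∫ y, χ y ^ 2 * ‖curl U y‖ ^ 2) +
          (∫ y, (1 / 2 * fderiv ℝ η y y + (Δ η) y + fderiv ℝ η y (U y)) * ‖curl U y‖ ^ 2) -
          2 * (∫ y, χ y ^ 2 * frobeniusNormSq (fderiv ℝ (curl U) y)) +
          2 * (∫ y, χ y ^ 2 * ⟪curl U y, fderiv ℝ U y (curl U y)⟫)) * -s
        = (c⁻¹ ^ 2 * -s) * (-(1 / 2) * (∫ y, χ y ^ 2 * ‖curl U y‖ ^ 2) +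
          (∫ y, (1 / 2 * fderiv ℝ η y y + (Δ η) y + fderiv ℝ η y (U y)) * ‖curl U y‖ ^ 2) -
          2 * (∫ y, χ y ^ 2 * frobeniusNormSq (fderiv ℝ (curl U) y)) +
          2 * (∫ y, χ y ^ 2 * ⟪curl U y, fderiv ℝ U y (curl U y)⟫)) := by ring
      _ ≤ θ ^ 2 / 16 - (∫ y, χ y ^ 2 * ‖curl U y‖ ^ 2) / 4 := by rw [hcs2, one_mul]; linarith
  -- continuity of `G` on `[t̄, t]` and the initial bound
  have hIcc : Icc tb t ⊆ Ioo (-(m ^ 2)) 0 := fun s hs => ⟨lt_of_lt_of_le htb.1 hs.1, lt_of_le_of_lt hs.2 ht.2⟩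
  have hcontG : ContinuousOn G (Icc tb t) := by
    intro s hs
    obtain ⟨g, hg, -⟩ := hstep s (hIcc hs)
    exact hg.continuousAt.continuousWithinAt
  have hGtb : G tb ≤ θ ^ 2 / 4 := by
    obtain ⟨htb1, -, -, -, h2, -, -⟩ := hscale tb htb
    rw [← hG]
    exact weightedEnstrophy_le_of_setLIntegral_le hreg hζ hζs hζ1 hut hχb0 hχb01 hR0 hη hψ htb1 rfl h2 Htb
  -- the barrier
  have hGt : G t ≤ θ ^ 2 / 4 := by
    refine le_of_deriv_barrier ht.1 ht.2 hθ hcontG (fun s hs hGs => ?_) hGtb t (right_mem_Icc.2 ht.1)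
    obtain ⟨g, hg, hgle⟩ := hstep s ⟨lt_trans htb.1 hs.1, lt_trans hs.2 ht.2⟩
    exact ⟨g, hg, hgle hGs⟩
  -- the profile at time `t` and the final bounds
  have htI : t ∈ Ioo (-(m ^ 2)) 0 := ⟨lt_of_lt_of_le htb.1 ht.1, ht.2⟩
  obtain ⟨ht1, hct, h5t, h4t, -, hR2t, hcc₁t⟩ := hscale t htI
  obtain ⟨c, hcs⟩ : ∃ c : ℝ, Real.sqrt (-t) = c := ⟨_, rfl⟩
  rw [hcs] at hct h5t h4t hR2t hcc₁t
  obtain ⟨U, hU⟩ : ∃ U : EuclideanSpace ℝ (Fin 3) → EuclideanSpace ℝ (Fin 3), U = fun y => c • ut t (c • y) :=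
    ⟨_, rfl⟩
  have hGtU : G t = ∫ y, χ y ^ 2 * ‖curl U y‖ ^ 2 := by
    rw [← hG]
    exact weightedEnstrophy_eq_profile hcs ht.2 hχ hη hψ hU
  have hU3 : ContDiff ℝ 3 U := profileAt_contDiff hreg hζ hζs hut ht1 hU
  have hdivU : ∀ y : EuclideanSpace ℝ (Fin 3), ‖y‖ < 5 * R → VectorCalculus.divergence U y = 0 :=
    fun y hy => profileAt_divergence_eq_zero hreg hζ1 hut ht1 hct h5t hU hy
  have h0U : ∀ y : EuclideanSpace ℝ (Fin 3), ‖y‖ ≤ 4 * R → ‖U y‖ ≤ Cu' / (1 + ‖y‖) := fun y hy =>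
    (profileAt_bounds hreg hI' hK' hK₂'' hζ hζs hζ1 hut ht1 hcs h4t hcc₁t hU hy).1
  -- the cut-off error of the final step is `≤ θ²`
  have hsmall : (2 * ‖curlCLM‖ ^ 2 + 1) * ((2 * C₁ / R) * (2 * Cu' / R)) ^ 2 *
      (volume (closedBall (0 : EuclideanSpace ℝ (Fin 3)) R)).toReal ≤ θ ^ 2 := by
    have hvolR : (volume (closedBall (0 : EuclideanSpace ℝ (Fin 3)) R)).toReal = R ^ 3 * v₁ := by
      have h := Measure.addHaar_real_closedBall (volume : Measure (EuclideanSpace ℝ (Fin 3)))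
        (0 : EuclideanSpace ℝ (Fin 3)) hR0.le
      rw [finrank_euclideanSpace_fin] at h
      rw [← measureReal_def, h, measureReal_def, hv₁]
    rw [hvolR, hκ]
    have e : (2 * κ ^ 2 + 1) * ((2 * C₁ / R) * (2 * Cu' / R)) ^ 2 * (R ^ 3 * v₁) =
        (16 * (2 * κ ^ 2 + 1) * C₁ ^ 2 * Cu' ^ 2 * v₁) / R := by
      field_simp
      ring
    rw [e, div_le_iff₀ hR0]
    have h1 : 16 * (2 * κ ^ 2 + 1) * C₁ ^ 2 * Cu' ^ 2 * v₁ = R₂ * θ ^ 2 := by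
      rw [hR₂]; field_simp
    rw [h1, mul_comm (θ ^ 2) R]
    exact mul_le_mul_of_nonneg_right hRR₂ (by positivity)
  have hGt' : ∫ y, χ y ^ 2 * ‖curl U y‖ ^ 2 ≤ θ ^ 2 / 4 := by rw [← hGtU]; exact hGt
  have hprof := setLIntegral_frobeniusNormSq_profile_le hχb3 hχb1 hχb0 hχb01 hC₁ hR4 hU3 hdivU hCu'0 h0U hχ
    hGt' hsmall
  have hphys := setLIntegral_frobeniusNormSq_physical_le hζ1 hut hct hU hR2t hR0 hprof
  rw [hcs]
  refine hphys.trans ?_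
  rw [← ENNReal.ofReal_mul (by positivity)]
  refine ENNReal.ofReal_le_ofReal ?_
  rw [div_eq_mul_inv, mul_comm]
  have : 0 < c⁻¹ := by positivity
  nlinarith [sq_nonneg θ]

end MainTheorem

end Literature.Analysis.FluidPDE

end
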